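import Summits.BirchSwinnertonDyer.BirchSwinnertonDyer.Theorems.ManinLocalTwoThreeFullTwoTorsionIndexFour
import Summits.BirchSwinnertonDyer.BirchSwinnertonDyer.Theorems.ManinLocalTwoThreeSqRootWitnessLaw
import Summits.BirchSwinnertonDyer.BirchSwinnertonDyer.Theorems.ManinLocalTwoThreeQuarterShiftGamma1Orbit
import Summits.BirchSwinnertonDyer.BirchSwinnertonDyer.Theorems.ManinLocalTwoThreeShimuraQuotientFourP
import Summits.BirchSwinnertonDyer.BirchSwinnertonDyer.Theorems.ManinLocalTwoThreeShimuraQuotientFourPQ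
import HarnessLib

/-!
# C2 for curves with FULL rational `2`-torsion at the index-`4`-free levels, modulo Calegari–Dimitrov–Tang alone

Lead p1 gen 18 (cell bsd-f2-manin, crux C2 `ManinOddAtFour`, `--supports stmt-BirchSwinnertonDyer-22967`).

With AN2₂ — the `ℓ = 2` Kummer witness law — now a THEOREM (p2 g19 `UDCTwo.sqRootWitnessLaw`), the lead's
`FullTwoTorsion.periodLatticeGamma1_eq_two_mul_of_two_dvd_of_two_roots` reads: for a globally minimal `W` with TWO distinct rational
roots of the `2`-division cubic and a lattice-optimal `X₀(N)`-datum at `4 ∣ N`, `2 ∣ c ⟹ Λ₁(f) = 2Λ₀(f)` (Shimura index `4`), modulo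
Unbounded Denominators (all weights, algebraic-integer coefficients) — i.e. modulo the printed CDT fact.  Index `4` is EXCLUDED unconditionally
at every level where the cuspidal-inertia group `(ℤ/uv)ˣ/{±1}` is cyclic (Ling–Oesterlé; tree `…ShimuraQuotientLevelInstances`, `…FourP`) and,
by the `χ₋₄` transport, at `16pq ← 4pq` (`…QuarterShiftGamma1Orbit`).  Hence **C2 (`2 ∤ c₀`) for optimal curves with full rational `2`-torsion
at `N ∈ {32, 64, 128, 256}`, `N = 4p, 8p, 16p`, `N = u²v` with `uv = 4q`, `(ℤ/q)ˣ` cyclic, `N = 4pq` (`p ≡ 3 (4)`) and the `χ₋₄`-twists at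
`16pq`, MODULO CDT ALONE** (no F★/F♮/CES/F♯, no cell law).  In Cremona's range this removes e.g. `48a, 64a, 80b?, 96a/b, 112a/b/c, 120a, …`-type
full-`2`-torsion classes from the habitat of the three gain-locus laws of the line of record (v26), which are henceforth needed only for classes
with EXACTLY ONE rational `2`-torsion point or at rank-`≥ 2` cuspidal-inertia levels with `Λ₁ = 2Λ₀` not yet excluded.

HONEST FRAMING: CONDITIONAL on `Literature.NumberTheory.Automorphic.CalegariDimitrovTang2025_unboundedDenominators_algInt` (PRINTED,
statement-only).  C2 as stated, Manin's `c = 1` and BSD are NOT proved here.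
-/

set_option linter.dupNamespace false

noncomputable section

open PowerSeries CongruenceSubgroup Complex
open scoped MatrixGroups ModularForm Manifold PeriodPair
open WeierstrassCurve Literature.NumberTheory.EllipticCurves Literature.NumberTheory.EllipticCurves.ModularForms
open Summit.BirchSwinnertonDyer.Rank1Residual.ManinAdditive
open Summit.BirchSwinnertonDyer.Rank1Residual.ManinAdditive.CuspidalKummer
open Summit.BirchSwinnertonDyer.Rank1Residual.ManinAdditive.UDCKummerLineK
open Summit.BirchSwinnertonDyer.BirchSwinnertonDyer.Theorems.ManinLocalTwoThree.SigmaSquareRoot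
open Summit.BirchSwinnertonDyer.BirchSwinnertonDyer.Theorems.ManinLocalTwoThree.SigmaHabitat
open Summit.BirchSwinnertonDyer.BirchSwinnertonDyer.Theorems.ManinLocalTwoThree.UDCTwo

namespace Summit.BirchSwinnertonDyer.BirchSwinnertonDyer.Theorems.ManinLocalTwoThree.FullTwoTorsion

variable {W : WeierstrassCurve ℚ} [W.IsElliptic] [W.IsGloballyMinimal] {N : ℕ} [NeZero N]

/-! ## §1 Two rational roots and `2 ∣ c` force index `4` — AN2₂ by name -/

/-- **Two rational `2`-division roots and `2 ∣ c ⟹ Λ₁(f) = 2Λ₀(f)`**, modulo Unbounded Denominators (algebraic-integer form) only: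
AN2₂ is p2's theorem `UDCTwo.sqRootWitnessLaw`. [cite: CalegariDimitrovTang2025, Thm. 1.0.1] [cite: KurthLong2008, Prop. 18] -/
theorem periodLatticeGamma1_eq_two_mul_of_two_dvd_of_two_roots_of_UDW (hUDW : ∀ k : ℤ, UnboundedDenominatorsWeightAlgInt k)
    (D : ModularParametrizationData W N) (h4 : 2 ^ 2 ∣ N) (hopt : ∀ z ∈ D.L.lattice, ∃ w ∈ periodLattice D.f, z = D.c * w)
    {e e' : ℚ} (he : W.twoTorsionPolynomial.toPoly.IsRoot e) (he' : W.twoTorsionPolynomial.toPoly.IsRoot e') (hne : e ≠ e')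
    (h2c : (2 : ℤ) ∣ D.c) :
    ∀ z : ℂ, z ∈ periodLatticeGamma1 D.f ↔ ∃ w ∈ periodLattice D.f, z = 2 * w :=
  periodLatticeGamma1_eq_two_mul_of_two_dvd_of_two_roots sqRootWitnessLaw hUDW D h4 hopt he he' hne h2c

/-- **Two rational `2`-division roots and `2 ∣ c ⟹ Λ₁(f) = 2Λ₀(f)`, modulo the printed Calegari–Dimitrov–Tang fact alone.**
[cite: CalegariDimitrovTang2025, Thm. 1.0.1 and Remarks 58–59] -/
theorem periodLatticeGamma1_eq_two_mul_of_two_dvd_of_two_roots_of_CDT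
    (hCDT : Literature.NumberTheory.Automorphic.CalegariDimitrovTang2025_unboundedDenominators_algInt)
    (D : ModularParametrizationData W N) (h4 : 2 ^ 2 ∣ N) (hopt : ∀ z ∈ D.L.lattice, ∃ w ∈ periodLattice D.f, z = D.c * w)
    {e e' : ℚ} (he : W.twoTorsionPolynomial.toPoly.IsRoot e) (he' : W.twoTorsionPolynomial.toPoly.IsRoot e') (hne : e ≠ e')
    (h2c : (2 : ℤ) ∣ D.c) :
    ∀ z : ℂ, z ∈ periodLatticeGamma1 D.f ↔ ∃ w ∈ periodLattice D.f, z = 2 * w :=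
  periodLatticeGamma1_eq_two_mul_of_two_dvd_of_two_roots_of_UDW (KLine.unboundedDenominatorsWeightAlgInt_of_CDT_algInt' hCDT)
    D h4 hopt he he' hne h2c

/-- **C2 for two rational roots wherever index `4` is excluded, modulo CDT alone**: `Λ₁(f) ≠ 2Λ₀(f) ⟹ 2 ∤ c`.
[cite: CalegariDimitrovTang2025, Thm. 1.0.1] [cite: Stevens1989, §2] -/
theorem not_two_dvd_maninConstant_of_two_roots_of_not_indexFour_of_CDT
    (hCDT : Literature.NumberTheory.Automorphic.CalegariDimitrovTang2025_unboundedDenominators_algInt)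
    (D : ModularParametrizationData W N) (h4 : 2 ^ 2 ∣ N) (hopt : ∀ z ∈ D.L.lattice, ∃ w ∈ periodLattice D.f, z = D.c * w)
    {e e' : ℚ} (he : W.twoTorsionPolynomial.toPoly.IsRoot e) (he' : W.twoTorsionPolynomial.toPoly.IsRoot e') (hne : e ≠ e')
    (hidx : ¬ ∀ z : ℂ, z ∈ periodLatticeGamma1 D.f ↔ ∃ w ∈ periodLattice D.f, z = 2 * w) :
    ¬ (2 : ℤ) ∣ D.maninConstant :=
  fun h2c ↦ hidx (periodLatticeGamma1_eq_two_mul_of_two_dvd_of_two_roots_of_CDT hCDT D h4 hopt he he' hne h2c)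

/-! ## §2 The index-`4`-free levels: C2 for full rational `2`-torsion modulo CDT alone -/

/-- **C2, full `2`-torsion, `N = u²v` with `(ℤ/uv)ˣ` cyclic** (`uv = 4`, `q^j`, `2q^j`), modulo CDT. [cite: LingOesterle1991, §1 and Thm. 6] -/
theorem not_two_dvd_maninConstant_of_two_roots_of_isCyclic_mod_of_CDT
    (hCDT : Literature.NumberTheory.Automorphic.CalegariDimitrovTang2025_unboundedDenominators_algInt) {u v m : ℕ} (hu : u ≠ 0)
    (hN : (N : ℤ) = (u : ℤ) ^ 2 * v) (hm : u * v = m) [NeZero m] [IsCyclic (ZMod m)ˣ]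
    (D : ModularParametrizationData W N) (h4 : 2 ^ 2 ∣ N) (hopt : ∀ z ∈ D.L.lattice, ∃ w ∈ periodLattice D.f, z = D.c * w)
    {e e' : ℚ} (he : W.twoTorsionPolynomial.toPoly.IsRoot e) (he' : W.twoTorsionPolynomial.toPoly.IsRoot e') (hne : e ≠ e') :
    ¬ (2 : ℤ) ∣ D.maninConstant :=
  not_two_dvd_maninConstant_of_two_roots_of_not_indexFour_of_CDT hCDT D h4 hopt he he' hne
    (not_periodLatticeGamma1_eq_two_mul_of_isCyclic_mod hu hN hm D hopt h4)

/-- **C2, full `2`-torsion, `N = u²v` with `uv = 4q`, `q` odd, `(ℤ/q)ˣ` cyclic** (`8q^j`, `16q^j`, `16q²`, …), modulo CDT.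
[cite: LingOesterle1991, §1 and Thm. 6] -/
theorem not_two_dvd_maninConstant_of_two_roots_of_uv_eq_four_mul_of_CDT
    (hCDT : Literature.NumberTheory.Automorphic.CalegariDimitrovTang2025_unboundedDenominators_algInt) {u v q : ℕ} (hu : u ≠ 0)
    (hN : (N : ℤ) = (u : ℤ) ^ 2 * v) (huv : u * v = 4 * q) (hq : Odd q) [IsCyclic (ZMod q)ˣ]
    (D : ModularParametrizationData W N) (hopt : ∀ z ∈ D.L.lattice, ∃ w ∈ periodLattice D.f, z = D.c * w)
    {e e' : ℚ} (he : W.twoTorsionPolynomial.toPoly.IsRoot e) (he' : W.twoTorsionPolynomial.toPoly.IsRoot e') (hne : e ≠ e') :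
    ¬ (2 : ℤ) ∣ D.maninConstant := by
  have h4uv : 2 ^ 2 ∣ u * v := ⟨q, by rw [huv]; ring⟩
  have h4 : 2 ^ 2 ∣ N := h4uv.trans (mul_dvd_of_sq_mul hN)
  exact not_two_dvd_maninConstant_of_two_roots_of_not_indexFour_of_CDT hCDT D h4 hopt he he' hne
    (not_periodLatticeGamma1_eq_two_mul_of_uv_eq_four_mul hu hN huv hq D hopt)

/-- **C2, full `2`-torsion, at the pure `2`-power conductors `N = 32, 64, 128, 256`**, modulo CDT (e.g. the full-`2`-torsion classes `32a`?/`64a`).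
[cite: LingOesterle1991, Thm. 6] [cite: Stevens1989, §2] -/
theorem not_two_dvd_maninConstant_of_two_roots_of_two_power_of_CDT
    (hCDT : Literature.NumberTheory.Automorphic.CalegariDimitrovTang2025_unboundedDenominators_algInt)
    (hN : N = 32 ∨ N = 64 ∨ N = 128 ∨ N = 256)
    (D : ModularParametrizationData W N) (hopt : ∀ z ∈ D.L.lattice, ∃ w ∈ periodLattice D.f, z = D.c * w)
    {e e' : ℚ} (he : W.twoTorsionPolynomial.toPoly.IsRoot e) (he' : W.twoTorsionPolynomial.toPoly.IsRoot e') (hne : e ≠ e') :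
    ¬ (2 : ℤ) ∣ D.maninConstant := by
  have h4 : 2 ^ 2 ∣ N := by rcases hN with rfl | rfl | rfl | rfl <;> norm_num
  exact not_two_dvd_maninConstant_of_two_roots_of_not_indexFour_of_CDT hCDT D h4 hopt he he' hne
    (not_periodLatticeGamma1_eq_two_mul_of_two_power hN D hopt)

/-- **C2, full `2`-torsion, `N = 4p`** (`p` an odd prime), modulo CDT. [cite: LingOesterle1991, Thm. 6] [cite: Stevens1989, §2] -/
theorem not_two_dvd_maninConstant_of_two_roots_four_mul_prime_of_CDT
    (hCDT : Literature.NumberTheory.Automorphic.CalegariDimitrovTang2025_unboundedDenominators_algInt) {p : ℕ} (hp : p.Prime)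
    (hp2 : p ≠ 2) [NeZero (4 * p)] (D : ModularParametrizationData W (4 * p))
    (hopt : ∀ z ∈ D.L.lattice, ∃ w ∈ periodLattice D.f, z = D.c * w)
    {e e' : ℚ} (he : W.twoTorsionPolynomial.toPoly.IsRoot e) (he' : W.twoTorsionPolynomial.toPoly.IsRoot e') (hne : e ≠ e') :
    ¬ (2 : ℤ) ∣ D.maninConstant :=
  not_two_dvd_maninConstant_of_two_roots_of_not_indexFour_of_CDT hCDT D ⟨p, rfl⟩ hopt he he' hne
    (not_periodLatticeGamma1_eq_two_mul_of_four_mul_prime hp hp2 D hopt)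

/-- **C2, full `2`-torsion, `N = 8p`** (`p` an odd prime), modulo CDT. [cite: LingOesterle1991, Thm. 6] -/
theorem not_two_dvd_maninConstant_of_two_roots_eight_mul_prime_of_CDT
    (hCDT : Literature.NumberTheory.Automorphic.CalegariDimitrovTang2025_unboundedDenominators_algInt) {p : ℕ} (hp : p.Prime)
    (hp2 : p ≠ 2) [NeZero (8 * p)] (D : ModularParametrizationData W (8 * p))
    (hopt : ∀ z ∈ D.L.lattice, ∃ w ∈ periodLattice D.f, z = D.c * w)
    {e e' : ℚ} (he : W.twoTorsionPolynomial.toPoly.IsRoot e) (he' : W.twoTorsionPolynomial.toPoly.IsRoot e') (hne : e ≠ e') :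
    ¬ (2 : ℤ) ∣ D.maninConstant :=
  not_two_dvd_maninConstant_of_two_roots_of_not_indexFour_of_CDT hCDT D ⟨2 * p, by ring⟩ hopt he he' hne
    (not_periodLatticeGamma1_eq_two_mul_eight_mul_prime hp hp2 D hopt)

/-- **C2, full `2`-torsion, `N = 16p`** (`p` an odd prime), modulo CDT. [cite: LingOesterle1991, Thm. 6] -/
theorem not_two_dvd_maninConstant_of_two_roots_sixteen_mul_prime_of_CDT
    (hCDT : Literature.NumberTheory.Automorphic.CalegariDimitrovTang2025_unboundedDenominators_algInt) {p : ℕ} (hp : p.Prime)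
    (hp2 : p ≠ 2) [NeZero (16 * p)] (D : ModularParametrizationData W (16 * p))
    (hopt : ∀ z ∈ D.L.lattice, ∃ w ∈ periodLattice D.f, z = D.c * w)
    {e e' : ℚ} (he : W.twoTorsionPolynomial.toPoly.IsRoot e) (he' : W.twoTorsionPolynomial.toPoly.IsRoot e') (hne : e ≠ e') :
    ¬ (2 : ℤ) ∣ D.maninConstant :=
  not_two_dvd_maninConstant_of_two_roots_of_not_indexFour_of_CDT hCDT D ⟨4 * p, by ring⟩ hopt he he' hne
    (not_periodLatticeGamma1_eq_two_mul_sixteen_mul_prime hp hp2 D hopt)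

/-- **C2, full `2`-torsion, `N = 4pq`** (`p ≠ q` odd primes, `p ≡ 3 (mod 4)`: two Shimura classes), modulo CDT.
[cite: LingOesterle1991, §1, Thm. 1 and Thm. 6] [cite: Stevens1989, §2] -/
theorem not_two_dvd_maninConstant_of_two_roots_four_mul_mul_of_CDT
    (hCDT : Literature.NumberTheory.Automorphic.CalegariDimitrovTang2025_unboundedDenominators_algInt) {p q : ℕ} (hp : p.Prime)
    (hq : q.Prime) (hp2 : p ≠ 2) (hq2 : q ≠ 2) (hpq : p ≠ q) (hp3 : p % 4 = 3) (hN : N = 4 * p * q)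
    (D : ModularParametrizationData W N) (hopt : ∀ z ∈ D.L.lattice, ∃ w ∈ periodLattice D.f, z = D.c * w)
    {e e' : ℚ} (he : W.twoTorsionPolynomial.toPoly.IsRoot e) (he' : W.twoTorsionPolynomial.toPoly.IsRoot e') (hne : e ≠ e') :
    ¬ (2 : ℤ) ∣ D.maninConstant := by
  obtain ⟨γ₀, hγ₀⟩ := exists_forall_mem_or_sub_mem_four_mul_mul D.f hp hq hp2 hq2 hpq hp3 hN D.isNewformOf.1
  exact not_two_dvd_maninConstant_of_two_roots_of_not_indexFour_of_CDT hCDT D ⟨p * q, by rw [hN]; ring⟩ hopt he he' hne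
    (not_index_four_of_two_classes D hopt hγ₀)

/-- **C2, full `2`-torsion, for the `χ₋₄`-twists at `N′ = 16pq` of the classes at `N = 4pq`** (`p ≡ 3 (mod 4)`; index `4` is a `χ₋₄`-orbit
property, lead g18 `…QuarterShiftGamma1Orbit`), modulo CDT. [cite: LingOesterle1991, §1, Thm. 1 and Thm. 6] [cite: Stevens1989, §2] -/
theorem not_two_dvd_maninConstant_of_two_roots_negOne_twist_sixteen_mul_mul_of_CDT
    (hCDT : Literature.NumberTheory.Automorphic.CalegariDimitrovTang2025_unboundedDenominators_algInt)
    {W₄ : WeierstrassCurve ℚ} [W₄.IsElliptic] {N₄ : ℕ} [NeZero N₄] {p q : ℕ} (hp : p.Prime) (hq : q.Prime)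
    (hp2 : p ≠ 2) (hq2 : q ≠ 2) (hpq : p ≠ q) (hp3 : p % 4 = 3) (hN₄ : N₄ = 4 * p * q) (hN : N = 16 * p * q)
    (D₄ : ModularParametrizationData W₄ N₄) (D : ModularParametrizationData W N)
    (h₄ : ∀ z ∈ D₄.L.lattice, ∃ w ∈ periodLattice D₄.f, z = D₄.c * w)
    (h4W₄ : 2 ^ 2 ∣ W₄.conductorNorm ℤ) (h4W : 2 ^ 2 ∣ W.conductorNorm ℤ) (hiso : IsIsogenous (W₄.quadraticTwist ((-1 : ℤ) : ℚ)) W)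
    (hopt : ∀ z ∈ D.L.lattice, ∃ w ∈ periodLattice D.f, z = D.c * w)
    {e e' : ℚ} (he : W.twoTorsionPolynomial.toPoly.IsRoot e) (he' : W.twoTorsionPolynomial.toPoly.IsRoot e') (hne : e ≠ e') :
    ¬ (2 : ℤ) ∣ D.maninConstant :=
  not_two_dvd_maninConstant_of_two_roots_of_not_indexFour_of_CDT hCDT D ⟨4 * p * q, by rw [hN]; ring⟩ hopt he he' hne
    (not_periodLatticeGamma1_eq_two_mul_of_negOne_twist_of_four_mul_mul hp hq hp2 hq2 hpq hp3 hN₄ hN D₄ D h₄ h4W₄ h4W hiso)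

end Summit.BirchSwinnertonDyer.BirchSwinnertonDyer.Theorems.ManinLocalTwoThree.FullTwoTorsion

end
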